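import Summits.KontsevichZagierPeriods.KontsevichZagierPeriods.Theses.FurushoPentagon
import Literature.NumberTheory.Transcendental.KZCalculus
import Literature.NumberTheory.Transcendental.MZVSimplexRep
import Literature.NumberTheory.Transcendental.SemialgebraicMapsProofs

/-!
# `HoffmanRelationInKZ`, line `dilation-homotopy-transposition`: cubical transport — tools

Support file for the stub `stub_cubicalTransport` of the crux `HoffmanRelationInKZ`
(stmt-KontsevichZagierPeriods-3930, route FurushoPentagon). Two groups of tools:

* **Monomial charts.** A map `C y = (∏_{j ∈ S i} y_j)_i` of `ℝᴺ`, for a family of finite sets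
  `S i ⊆ {j ≤ i}` containing the diagonal, is polynomial (hence `ℚ`-semialgebraic), differentiable
  (`hasFDerivAt_pi`, `hasFDerivAt_finsetProd`) with LOWER-TRIANGULAR Jacobian, whose determinant is
  the product of the diagonal entries (`Matrix.det_of_lowerTriangular`); `monomialChart_transport`
  packages ONE `KZ.changeOfVariablesRel` move along such a chart (existence of the pulled-back
  representation by `MeasureTheory.integrableOn_image_iff_integrableOn_abs_det_fderiv_smul`, and
  the equivalence). Both the cubical chart `tᵢ = x₀⋯xᵢ` of the ordered simplex and its version
  with a spectator coordinate are monomial charts.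
* **The block identity.** With `T_m x = x₀⋯x_{m-1}`, Kontsevich's integrand `∏ᵢ ω_{εᵢ}(tᵢ)` of
  `ζ(s)` at `tᵢ = T_{i+1} x`, multiplied by the Jacobian `∏ᵢ T_i x`, is the cubical integrand
  `∏_l T_{p_l} x / (1 − T_{p_{l+1}} x)` (`p_l = s₁ + ⋯ + s_l`): letterwise `ω₀(T_{i+1}) T_i = 1/xᵢ`,
  `ω₁(T_{i+1}) T_i = T_i/(1 − T_{i+1})`, and the `1/xᵢ` of each block cancel
  (`stub_cubicalPullback`, by induction on `s` through the `ℕ`-indexed `blockIdentity_nat`).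

References: M. Kontsevich, D. Zagier, *Periods* (2001), §1.2 rule (2); D. Zagier, *Values of zeta
functions and their applications* (1994), §9.
-/

noncomputable section

open Set MeasureTheory MvPolynomial
open Literature.NumberTheory.Transcendental
open Literature.ModelTheory.ExponentialFields (IsSemialgebraic)

namespace Summit.KontsevichZagierPeriods.FurushoPentagon.HoffmanRelationInKZ

/-! ### Monomial charts: derivative, triangular Jacobian, semialgebraicity, transport -/

/-- Determinant of a "pi of finite sums of coordinate projections" continuous linear map of `ℝᴺ`
whose `i`-th row is supported on indices `j ≤ i`: the matrix is lower-triangular, so the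
determinant is the product of the diagonal coefficients. [folklore] -/
theorem det_pi_sum_smul_proj {N : ℕ} (S : Fin N → Finset (Fin N)) (c : Fin N → Fin N → ℝ)
    (hS : ∀ i, ∀ j ∈ S i, j ≤ i) :
    (ContinuousLinearMap.pi fun i => ∑ j ∈ S i,
        c i j • ContinuousLinearMap.proj (R := ℝ) (φ := fun _ : Fin N => ℝ) j).det
      = ∏ i, if i ∈ S i then c i i else 0 := by
  classical
  set L : (Fin N → ℝ) →L[ℝ] (Fin N → ℝ) := ContinuousLinearMap.pi fun i => ∑ j ∈ S i,
    c i j • ContinuousLinearMap.proj (R := ℝ) (φ := fun _ : Fin N => ℝ) j with hL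
  have hentry : ∀ i j, LinearMap.toMatrix' (L : (Fin N → ℝ) →ₗ[ℝ] (Fin N → ℝ)) i j =
      if j ∈ S i then c i j else 0 := by
    intro i j
    rw [LinearMap.toMatrix'_apply]
    simp [hL, Pi.single_apply, Finset.sum_ite_eq']
  have hdet : L.det = (LinearMap.toMatrix' (L : (Fin N → ℝ) →ₗ[ℝ] (Fin N → ℝ))).det := by
    rw [ContinuousLinearMap.det, LinearMap.det_toMatrix']
  rw [hdet, Matrix.det_of_lowerTriangular _ ?_]
  · exact Finset.prod_congr rfl fun i _ => hentry i i
  · intro i j hij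
    have hij' : i < j := hij
    rw [hentry, if_neg]
    exact fun h => absurd (hS i j h) (not_le.mpr hij')

/-- The monomial chart `y ↦ (∏_{j ∈ S i} y_j)_i` of `ℝᴺ` is differentiable, with derivative the
"pi of sums" continuous linear map given by the Leibniz rule. [folklore] -/
theorem hasFDerivAt_monomialChart {N : ℕ} (S : Fin N → Finset (Fin N)) (y : Fin N → ℝ) :
    HasFDerivAt (fun (y : Fin N → ℝ) (i : Fin N) => ∏ j ∈ S i, y j)
      (ContinuousLinearMap.pi fun i => ∑ j ∈ S i, (∏ k ∈ (S i).erase j, y k) •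
        ContinuousLinearMap.proj (R := ℝ) (φ := fun _ : Fin N => ℝ) j) y := by
  classical
  exact hasFDerivAt_pi.mpr fun i => hasFDerivAt_finsetProd

/-- The Jacobian determinant of the monomial chart with rows supported on `j ≤ i` and containing
the diagonal is `∏ᵢ ∏_{k ∈ S i, k ≠ i} y_k`. [folklore] -/
theorem det_monomialChart {N : ℕ} (S : Fin N → Finset (Fin N)) (hS : ∀ i, ∀ j ∈ S i, j ≤ i)
    (hS' : ∀ i, i ∈ S i) (y : Fin N → ℝ) :
    (ContinuousLinearMap.pi fun i => ∑ j ∈ S i, (∏ k ∈ (S i).erase j, y k) •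
        ContinuousLinearMap.proj (R := ℝ) (φ := fun _ : Fin N => ℝ) j).det
      = ∏ i, ∏ k ∈ (S i).erase i, y k := by
  rw [det_pi_sum_smul_proj S (fun i j => ∏ k ∈ (S i).erase j, y k) hS]
  exact Finset.prod_congr rfl fun i _ => if_pos (hS' i)

/-- The monomial chart is a polynomial map, hence `ℚ`-semialgebraic on every `ℚ`-semialgebraic
set. [cite: BochnakCosteRoy1998, §2.2] -/
theorem isSemialgebraicMapOn_monomialChart {N : ℕ} (S : Fin N → Finset (Fin N))
    {σ : Set (Fin N → ℝ)} (hσ : IsSemialgebraic ℚ σ) :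
    IsSemialgebraicMapOn ℚ σ (fun (y : Fin N → ℝ) (i : Fin N) => ∏ j ∈ S i, y j) := by
  convert isSemialgebraicMapOn_aeval hσ (fun i => ∏ j ∈ S i, (X j : MvPolynomial (Fin N) ℚ))
    using 3 with y i
  simp [map_prod]

/-- The Jacobian `|∏ᵢ ∏_{k ∈ S i, k ≠ i} y_k|` of a monomial chart is a `ℚ`-semialgebraic function
on every `ℚ`-semialgebraic set (absolute value of a polynomial).
[cite: BochnakCosteRoy1998, §2.2] -/
theorem isSemialgebraicFunOn_monomialChart_jacobian {N : ℕ} (S : Fin N → Finset (Fin N))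
    {σ : Set (Fin N → ℝ)} (hσ : IsSemialgebraic ℚ σ) :
    IsSemialgebraicFunOn ℚ σ (fun y : Fin N → ℝ => |∏ i, ∏ k ∈ (S i).erase i, y k|) := by
  refine IsSemialgebraicFunOn.abs ?_
  refine (isSemialgebraicFunOn_aeval hσ (∏ i, ∏ k ∈ (S i).erase i,
    (X k : MvPolynomial (Fin N) ℚ))).congr fun y _ => ?_
  simp [map_prod]

/-- **Transport along a monomial chart** (one KZ change-of-variables move). Let
`C y = (∏_{j ∈ S i} y_j)_i` be a monomial chart with rows supported on `j ≤ i` and containing the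
diagonal, injective on a `ℚ`-semialgebraic `D`, and let `g = (h ∘ C) · |Jac C|` on `D`. Then:
(i) if SOME integral representation has domain `C '' D` and integrand `h` there, the pair `(D, g)`
IS an integral representation (semialgebraicity by composition, absolute integrability transported
by `MeasureTheory.integrableOn_image_iff_integrableOn_abs_det_fderiv_smul`); (ii) every
representation `(D, ≡ g)` is KZ-equivalent to every representation `(C '' D, ≡ h)` by ONE
`KZ.changeOfVariablesRel` move. [cite: KontsevichZagier2001, §1.2 rule (2)] -/
theorem monomialChart_transport {N : ℕ} (S : Fin N → Finset (Fin N))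
    (hS : ∀ i, ∀ j ∈ S i, j ≤ i) (hS' : ∀ i, i ∈ S i) {D : Set (Fin N → ℝ)}
    (hD : IsSemialgebraic ℚ D) (C : (Fin N → ℝ) → (Fin N → ℝ)) (hC : ∀ y i, C y i = ∏ j ∈ S i, y j)
    (hinj : InjOn C D) (g h : (Fin N → ℝ) → ℝ)
    (hgh : ∀ y ∈ D, g y = h (C y) * |∏ i, ∏ k ∈ (S i).erase i, y k|) :
    (∀ r' : KZ.IntegralRep N, r'.domain = C '' D → EqOn r'.integrand h r'.domain →
        ∃ r : KZ.IntegralRep N, r.domain = D ∧ r.integrand = g) ∧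
    (∀ r r' : KZ.IntegralRep N, r.domain = D → EqOn r.integrand g D → r'.domain = C '' D →
        EqOn r'.integrand h r'.domain → KZ.Equivalent r r') := by
  obtain rfl : C = fun y i => ∏ j ∈ S i, y j := funext fun y => funext fun i => hC y i
  set C : (Fin N → ℝ) → (Fin N → ℝ) := fun y i => ∏ j ∈ S i, y j with hC_def
  set C' : (Fin N → ℝ) → (Fin N → ℝ) →L[ℝ] (Fin N → ℝ) := fun y =>
    ContinuousLinearMap.pi fun i => ∑ j ∈ S i, (∏ k ∈ (S i).erase j, y k) •
      ContinuousLinearMap.proj (R := ℝ) (φ := fun _ : Fin N => ℝ) j with hC'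
  have hderiv : ∀ y, HasFDerivAt C (C' y) y := hasFDerivAt_monomialChart S
  have hdet : ∀ y, (C' y).det = ∏ i, ∏ k ∈ (S i).erase i, y k := det_monomialChart S hS hS'
  have hCsa : IsSemialgebraicMapOn ℚ D C := isSemialgebraicMapOn_monomialChart S hD
  have hDm : MeasurableSet D :=
    Literature.ModelTheory.ExponentialFields.IsSemialgebraic.measurableSet_holds hD
  have hJsa := isSemialgebraicFunOn_monomialChart_jacobian S hD
  constructor
  · intro r' hdom' hint'
    have hh : IsSemialgebraicFunOn ℚ (C '' D) h := by
      have := r'.isSemialgebraicFunOn_integrand.congr hint'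
      rwa [hdom'] at this
    have hgsa : IsSemialgebraicFunOn ℚ D g :=
      (IsSemialgebraicFunOn.mul_holds (IsSemialgebraicFunOn.comp_isSemialgebraicMapOn_holds hh
        hCsa (mapsTo_image C D)) hJsa).congr fun y hy => by
          simp only [Pi.mul_apply, Function.comp_apply, hgh y hy]
    have hgi : IntegrableOn g D := by
      have h1 : IntegrableOn h (C '' D) := by
        have := r'.integrableOn.congr_fun hint' (KZ.IntegralRep.measurableSet_domain_holds r')
        rwa [hdom'] at this
      have h2 := (integrableOn_image_iff_integrableOn_abs_det_fderiv_smul volume hDm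
        (fun y _ => (hderiv y).hasFDerivWithinAt) hinj h).mp h1
      refine h2.congr_fun (fun y hy => ?_) hDm
      show |(C' y).det| • h (C y) = g y
      rw [smul_eq_mul, mul_comm, hdet, hgh y hy]
    exact ⟨⟨D, g, hD, hgsa, hgi⟩, rfl, rfl⟩
  · intro r r' hdom hint hdom' hint'
    refine KZ.changeOfVariablesRel_subset_relations ⟨N, r, r', C, C', hdom ▸ hCsa,
      fun y _ => (hderiv y).hasFDerivWithinAt, hdom ▸ hinj, by rw [hdom', hdom],
      fun y hy => ?_, rfl⟩
    rw [hdom] at hy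
    have hy' : C y ∈ r'.domain := hdom' ▸ mem_image_of_mem C hy
    rw [hint hy, hint' hy', hdet, hgh y hy]

/-! ### Partial products `T m x = x₀ ⋯ x_{m-1}` -/

/-- `T 0 x = 1`. [folklore] -/
theorem partialProd_zero {n : ℕ} (T : ℕ → (Fin n → ℝ) → ℝ)
    (hT : ∀ m x, T m x = ∏ j : Fin n, if (j : ℕ) < m then x j else 1) (x : Fin n → ℝ) :
    T 0 x = 1 := by
  simp [hT]

/-- `T (m+1) x = T m x · x_m` (with `x_m = 1` beyond the dimension). [folklore] -/
theorem partialProd_succ {n : ℕ} (T : ℕ → (Fin n → ℝ) → ℝ)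
    (hT : ∀ m x, T m x = ∏ j : Fin n, if (j : ℕ) < m then x j else 1) (x : Fin n → ℝ) (m : ℕ) :
    T (m + 1) x = T m x * (if h : m < n then x ⟨m, h⟩ else 1) := by
  rw [hT, hT]
  have hsplit : ∀ j : Fin n, (if (j : ℕ) < m + 1 then x j else 1) =
      (if (j : ℕ) < m then x j else 1) * (if (j : ℕ) = m then x j else 1) := by
    intro j
    by_cases h1 : (j : ℕ) < m
    · rw [if_pos (by omega), if_pos h1, if_neg (by omega), mul_one]
    · by_cases h2 : (j : ℕ) = m
      · rw [if_pos (by omega), if_neg h1, if_pos h2, one_mul]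
      · rw [if_neg (by omega), if_neg h1, if_neg h2, one_mul]
  rw [Finset.prod_congr rfl fun j _ => hsplit j, Finset.prod_mul_distrib]
  congr 1
  by_cases h : m < n
  · rw [dif_pos h]
    have : ∀ j : Fin n, ((j : ℕ) = m) = (j = ⟨m, h⟩) := fun j => by
      rw [Fin.ext_iff]
    simp_rw [this]
    rw [Finset.prod_ite_eq']
    simp
  · rw [dif_neg h]
    refine Finset.prod_eq_one fun j _ => ?_
    rw [if_neg]
    intro hj
    exact h (hj ▸ j.isLt)

/-- `T m x` as a `Finset.range` product of the extension of `x` by `1`. [folklore] -/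
theorem partialProd_eq_prod_range {n : ℕ} (T : ℕ → (Fin n → ℝ) → ℝ)
    (hT : ∀ m x, T m x = ∏ j : Fin n, if (j : ℕ) < m then x j else 1) (x : Fin n → ℝ) (m : ℕ) :
    T m x = ∏ j ∈ Finset.range m, (if h : j < n then x ⟨j, h⟩ else 1) := by
  induction m with
  | zero => simp [hT]
  | succ m ih => rw [partialProd_succ T hT, ih, Finset.prod_range_succ]

/-- On the open unit cube: `0 < T m x ≤ 1`. [folklore] -/
theorem partialProd_pos_le {n : ℕ} (T : ℕ → (Fin n → ℝ) → ℝ)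
    (hT : ∀ m x, T m x = ∏ j : Fin n, if (j : ℕ) < m then x j else 1) {x : Fin n → ℝ}
    (hx : ∀ i, x i ∈ Ioo (0 : ℝ) 1) (m : ℕ) : 0 < T m x ∧ T m x ≤ 1 := by
  rw [hT]
  refine ⟨Finset.prod_pos fun j _ => ?_, Finset.prod_le_one (fun j _ => ?_) fun j _ => ?_⟩
  · split_ifs
    · exact (hx j).1
    · exact one_pos
  · split_ifs
    · exact (hx j).1.le
    · exact zero_le_one
  · split_ifs
    · exact (hx j).2.le
    · exact le_rfl

/-- On the open unit cube of positive dimension: `T (m+1) x < 1`. [folklore] -/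
theorem partialProd_succ_lt_one {n : ℕ} (T : ℕ → (Fin n → ℝ) → ℝ)
    (hT : ∀ m x, T m x = ∏ j : Fin n, if (j : ℕ) < m then x j else 1) {x : Fin n → ℝ}
    (hx : ∀ i, x i ∈ Ioo (0 : ℝ) 1) (hn : 0 < n) (m : ℕ) : T (m + 1) x < 1 := by
  induction m with
  | zero =>
    rw [partialProd_succ T hT, partialProd_zero T hT, one_mul, dif_pos hn]
    exact (hx _).2
  | succ m ih =>
    rw [partialProd_succ T hT]
    have h0 := (partialProd_pos_le T hT hx (m + 1)).1
    split_ifs with h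
    · calc T (m + 1) x * x ⟨m + 1, h⟩ < T (m + 1) x * 1 :=
            mul_lt_mul_of_pos_left (hx _).2 h0
        _ < 1 := by rw [mul_one]; exact ih
    · rw [mul_one]; exact ih

/-! ### The letters of the binary word and the block identity -/

/-- The letters of the word of `(b+1) :: s`: `b` letters `0`, then `1`, then the word of `s`.
[cite: Zagier1994, §9] -/
theorem getD_binaryWord_succ_cons (b : ℕ) (s : List ℕ) (i : ℕ) :
    (MZV.binaryWord ((b + 1) :: s)).getD i false =
      if i < b then false else if i = b then true
      else (MZV.binaryWord s).getD (i - (b + 1)) false := by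
  rw [MZV.binaryWord, Nat.add_sub_cancel]
  split_ifs with h1 h2
  · rw [List.getD_append _ _ _ _ (by simp; omega), List.getD_append _ _ _ _ (by simpa using h1),
      List.getD_replicate _ h1]
  · subst h2
    rw [List.getD_append _ _ _ _ (by simp), List.getD_append_right _ _ _ _ (by simp)]
    simp
  · rw [List.getD_append_right _ _ _ _ (by simp; omega)]
    simp

/-- **Block identity** (letterwise pull-back of Kontsevich's forms along the cubical chart, grouped
in blocks): with `P m = y₀ ⋯ y_{m-1}`,
`∏_{i < |s|} (ε_i ? c P_i/(1 − c P_{i+1}) : 1/y_i) = ∏_{l < k} c P_{p_l}/(1 − c P_{p_{l+1}})`,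
`p_l = s₁ + ⋯ + s_l`, for every index `s` with positive entries. [folklore] -/
theorem blockIdentity_nat (s : List ℕ) (hs : ∀ a ∈ s, 1 ≤ a) (y : ℕ → ℝ) (hy : ∀ j, y j ≠ 0)
    (c : ℝ) :
    ∏ i ∈ Finset.range s.sum,
        (if (MZV.binaryWord s).getD i false then
          c * (∏ j ∈ Finset.range i, y j) / (1 - c * ∏ j ∈ Finset.range (i + 1), y j)
        else 1 / y i)
      = ∏ l ∈ Finset.range s.length,
          c * (∏ j ∈ Finset.range (s.take l).sum, y j) /
            (1 - c * ∏ j ∈ Finset.range (s.take (l + 1)).sum, y j) := by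
  induction s generalizing y c with
  | nil => simp
  | cons a s ih =>
    obtain ⟨b, rfl⟩ : ∃ b, a = b + 1 := ⟨a - 1, by have := hs a (by simp); omega⟩
    have hs' : ∀ a ∈ s, 1 ≤ a := fun a ha => hs a (by simp [ha])
    -- split the left product at `b + 1`
    rw [List.sum_cons, Finset.prod_range_add, Finset.prod_range_succ]
    -- the first block
    have h1 : ∏ i ∈ Finset.range b,
        (if (MZV.binaryWord ((b + 1) :: s)).getD i false then
          c * (∏ j ∈ Finset.range i, y j) / (1 - c * ∏ j ∈ Finset.range (i + 1), y j)
        else 1 / y i) = (∏ j ∈ Finset.range b, y j)⁻¹ := by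
      rw [← Finset.prod_inv_distrib]
      refine Finset.prod_congr rfl fun i hi => ?_
      rw [getD_binaryWord_succ_cons, if_pos (Finset.mem_range.mp hi)]
      simp
    have h2 : (if (MZV.binaryWord ((b + 1) :: s)).getD b false then
          c * (∏ j ∈ Finset.range b, y j) / (1 - c * ∏ j ∈ Finset.range (b + 1), y j)
        else 1 / y b) =
        c * (∏ j ∈ Finset.range b, y j) / (1 - c * ∏ j ∈ Finset.range (b + 1), y j) := by
      rw [getD_binaryWord_succ_cons, if_neg (lt_irrefl b), if_pos rfl, if_pos rfl]
    -- the shifted tail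
    have h3 : ∏ i ∈ Finset.range s.sum,
        (if (MZV.binaryWord ((b + 1) :: s)).getD (b + 1 + i) false then
          c * (∏ j ∈ Finset.range (b + 1 + i), y j) /
            (1 - c * ∏ j ∈ Finset.range (b + 1 + i + 1), y j)
        else 1 / y (b + 1 + i)) =
        ∏ i ∈ Finset.range s.sum,
        (if (MZV.binaryWord s).getD i false then
          (c * ∏ j ∈ Finset.range (b + 1), y j) * (∏ j ∈ Finset.range i, y (b + 1 + j)) /
            (1 - (c * ∏ j ∈ Finset.range (b + 1), y j) * ∏ j ∈ Finset.range (i + 1), y (b + 1 + j))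
        else 1 / y (b + 1 + i)) := by
      refine Finset.prod_congr rfl fun i _ => ?_
      rw [getD_binaryWord_succ_cons, if_neg (show ¬ (b + 1 + i < b) by omega),
        if_neg (show b + 1 + i ≠ b by omega), show b + 1 + i - (b + 1) = i by omega,
        show b + 1 + i + 1 = (b + 1) + (i + 1) by omega, Finset.prod_range_add _ (b + 1) i,
        Finset.prod_range_add _ (b + 1) (i + 1)]
      simp only [mul_assoc]
    rw [h1, h2, h3,
      ih hs' (fun j => y (b + 1 + j)) (fun j => hy _) (c * ∏ j ∈ Finset.range (b + 1), y j)]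
    set A := ∏ j ∈ Finset.range (b + 1), y j with hA
    set B := ∏ j ∈ Finset.range b, y j with hB
    have hPb : B ≠ 0 := Finset.prod_ne_zero_iff.mpr fun j _ => hy j
    have h5 : B⁻¹ * (c * B / (1 - c * A)) = c / (1 - c * A) := by
      rw [mul_comm c B, mul_div_assoc, inv_mul_cancel_left₀ hPb]
    rw [h5]
    have h4 : ∀ S, ∏ j ∈ Finset.range (b + 1 + S), y j = A * ∏ j ∈ Finset.range S, y (b + 1 + j) :=
      fun S => by rw [hA]; exact Finset.prod_range_add _ _ _
    -- the right-hand side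
    rw [List.length_cons, Finset.prod_range_succ' _ s.length]
    simp only [List.take_succ_cons, List.take_zero, List.sum_cons, List.sum_nil, add_zero,
      Finset.range_zero, Finset.prod_empty, mul_one, h4, mul_assoc]
    exact mul_comm _ _


/-- **The cubical pull-back identity.** For an index `s` with positive entries, weight `n`, and
`x` with non-zero coordinates:
`(∏ᵢ ω_{εᵢ}(T_{i+1} x)) · ∏ᵢ T_i x = ∏_l T_{p_l} x / (1 − T_{p_{l+1}} x)` —
Kontsevich's integrand at `tᵢ = x₀⋯xᵢ` times the Jacobian `∏ᵢ T_i x` is the cubical integrand.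
[cite: KontsevichZagier2001, §1.2 rule (2)] -/
theorem stub_cubicalPullback : ∀ (s : List ℕ), (∀ a ∈ s, 1 ≤ a) → ∀ (T : ℕ → (Fin (MZV.weight s) → ℝ) → ℝ), (∀ m x, T m x = ∏ j : Fin (MZV.weight s), if (j : ℕ) < m then x j else 1) → ∀ (x : Fin (MZV.weight s) → ℝ), (∀ i, x i ≠ 0) → KZ.mzvIntegrand s (fun i => T ((i : ℕ) + 1) x) * ∏ i : Fin (MZV.weight s), T i x = ∏ l : Fin s.length, T (s.take l).sum x / (1 - T (s.take ((l : ℕ) + 1)).sum x) := by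
  intro s hs T hT x hx
  set y : ℕ → ℝ := fun m => if h : m < MZV.weight s then x ⟨m, h⟩ else 1 with hy
  have hy0 : ∀ j, y j ≠ 0 := by
    intro j
    simp only [hy]
    split_ifs with h
    exacts [hx _, one_ne_zero]
  have hP : ∀ m, T m x = ∏ j ∈ Finset.range m, y j := partialProd_eq_prod_range T hT x
  have hpt : ∀ i : Fin (MZV.weight s),
      KZ.mzvForm ((MZV.binaryWord s).getD i false) (T ((i : ℕ) + 1) x) * T i x =
      (fun m : ℕ => if (MZV.binaryWord s).getD m false then
          1 * (∏ j ∈ Finset.range m, y j) / (1 - 1 * ∏ j ∈ Finset.range (m + 1), y j)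
        else 1 / y m) i := by
    intro i
    have hTi : T i x ≠ 0 := by
      rw [hP]; exact Finset.prod_ne_zero_iff.mpr fun j _ => hy0 j
    simp only [KZ.mzvForm]
    split_ifs with h
    · rw [hP, hP]; ring
    · rw [hP ((i : ℕ) + 1), Finset.prod_range_succ, ← hP i]
      field_simp
  calc KZ.mzvIntegrand s (fun i => T ((i : ℕ) + 1) x) * ∏ i : Fin (MZV.weight s), T i x
      = ∏ i : Fin (MZV.weight s), (fun m : ℕ => if (MZV.binaryWord s).getD m false then
          1 * (∏ j ∈ Finset.range m, y j) / (1 - 1 * ∏ j ∈ Finset.range (m + 1), y j)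
        else 1 / y m) i := by
        unfold KZ.mzvIntegrand
        rw [← Finset.prod_mul_distrib]
        exact Finset.prod_congr rfl fun i _ => hpt i
    _ = ∏ i ∈ Finset.range (MZV.weight s), (if (MZV.binaryWord s).getD i false then
          1 * (∏ j ∈ Finset.range i, y j) / (1 - 1 * ∏ j ∈ Finset.range (i + 1), y j)
        else 1 / y i) :=
        Fin.prod_univ_eq_prod_range (fun m : ℕ => if (MZV.binaryWord s).getD m false then
          1 * (∏ j ∈ Finset.range m, y j) / (1 - 1 * ∏ j ∈ Finset.range (m + 1), y j)
        else 1 / y m) (MZV.weight s)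
    _ = ∏ l ∈ Finset.range s.length, 1 * (∏ j ∈ Finset.range (s.take l).sum, y j) /
            (1 - 1 * ∏ j ∈ Finset.range (s.take (l + 1)).sum, y j) := blockIdentity_nat s hs y hy0 1
    _ = ∏ l : Fin s.length, 1 * (∏ j ∈ Finset.range (s.take l).sum, y j) /
            (1 - 1 * ∏ j ∈ Finset.range (s.take ((l : ℕ) + 1)).sum, y j) :=
        (Fin.prod_univ_eq_prod_range (fun l => 1 * (∏ j ∈ Finset.range (s.take l).sum, y j) /
            (1 - 1 * ∏ j ∈ Finset.range (s.take (l + 1)).sum, y j)) _).symm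
    _ = ∏ l : Fin s.length, T (s.take l).sum x / (1 - T (s.take ((l : ℕ) + 1)).sum x) := by
        simp only [one_mul, hP]

end Summit.KontsevichZagierPeriods.FurushoPentagon.HoffmanRelationInKZ
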